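import Summits.ValiantsHypothesis.ValiantsHypothesis.Theorems.KPlusLogSqLawTropicalBChordSlack

/-!
# Route «KPlusLogSqLaw», crux `TropicalB` (stmt-ValiantsHypothesis-19771) — the HULL CRITERION:
# sandwich on the chain + one chord inequality per other present term ⇒ every chain term is the unique optimum (LP-free certificate)

HONEST FRAMING.  Helper file (cell `pub-symmetroid`, seat val-sym-trop-p1 g32, 2026-08-29; Newton-polygon docket) `--supports` the crux
`Summit.ValiantsHypothesis.ValiantsHypothesis.Theses.KPlusLogSqLaw.TropicalB` (item `stmt-ValiantsHypothesis-19771`, registered stubs `stub_tropThin` /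
`stub_tropFat` of `Cruxes/TropicalB/Lines/birth.lean`).  A CONSTRUCTIVE tool valid at every format (a sufficient condition for dominance, the converse
companion of `NewtonPolygon.sandwich`); it proves no census bound and asserts nothing about `TropicalB` in its window, `WeakLifting`, DoorA26 / DoorA34,
`MatrixDescartes` (stmt-ValiantsHypothesis-18050) or VP ≠ VNP.  Def-free.

THE CRITERION (`HullCriterion.isDominant_of_hull`).  Let `P 0, …, P n` be PRESENT terms of a design `(d, v, ε)` with Newton-polygon coordinates
`x i = IntervalOpt.sl d univ (P i)` (total exponent) and `V i = IntervalOpt.cst v univ (P i)` (valuation sum), and let `Θ 0 < Θ 1 < ⋯ < Θ n` be integers with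
the SANDWICH `Θ i·(x (i+1) − x i) < V (i+1) − V i < Θ (i+1)·(x (i+1) − x i)` at every step.  Suppose every OTHER present term `q` (present, `q ≠ P k` for all
`k ≤ n`) satisfies ONE of: (L) `x_q < x 0` and `Θ 0·(x 0 − x_q) > V 0 − V_q` (below the left supporting ray); (R) `x n < x_q` and `Θ n·(x_q − x n) < V_q − V n`
(below the right ray); (C) for some `k < n`, `x k ≤ x_q ≤ x (k+1)` and `(V_q − V k)·(x (k+1) − x k) > (x_q − x k)·(V (k+1) − V k)` (strictly below the chord
of step `k`).  THEN every `P j` (`j ≤ n`) is the unique optimum at `Θ j` (`IsDominant d v ε (Θ j) (P j)`).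
So a prescribed chain is certified by `2n` chain inequalities plus ONE inequality per competitor (instead of `n + 1` per competitor), and for a RIGID support
(every present term is a chain term, `isDominant_of_rigid`) by the sandwich alone.  The tree's PARABOLA CRITERION (`isDominant_of_parabola`, val-sym-trop-p4 g2)
is the instance «chain on a parabola, competitors at depth ≥ D»; the coupled-register and binary-counter certificates of the cell are instances of the rigid /
chord forms.  Proof: the chord laws `ChordSlack.lt_chord` / `ChordSlack.chord_lt` (this seat, ✓p730180) give `Θ j·x i − V i < Θ j·x j − V j` for chain terms
`i ≠ j`; a competitor below a chord is a convex combination of the chord's ends in `x` with a strictly worse `V`, and one below an end ray is compared through the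
end term.  [folklore: vertices of the upper hull are exactly the unique maximisers of linear functionals]
-/

set_option linter.dupNamespace false
set_option autoImplicit false

namespace Summit.ValiantsHypothesis.ValiantsHypothesis.Theorems.KPlusLogSqLaw

open Summit.ValiantsHypothesis.ValiantsHypothesis.Theorems.MatrixDescartes.Negative
open Finset

namespace HullCriterion

variable {m K : ℕ} (d : Fin K → ℕ) (v ε : Fin m → Fin m → Fin K → ℤ)
  {n : ℕ} {Θ : ℕ → ℤ} {P : ℕ → Equiv.Perm (Fin m) × (Fin m → Fin K)}
  (hΘ : ∀ i, i < n → Θ i < Θ (i + 1))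
  (hsw : ∀ i, i < n →
    Θ i * (IntervalOpt.sl d univ (P (i + 1)) - IntervalOpt.sl d univ (P i)) < IntervalOpt.cst v univ (P (i + 1)) - IntervalOpt.cst v univ (P i) ∧
      IntervalOpt.cst v univ (P (i + 1)) - IntervalOpt.cst v univ (P i) < Θ (i + 1) * (IntervalOpt.sl d univ (P (i + 1)) - IntervalOpt.sl d univ (P i)))
include hΘ hsw

/-- **chain terms under the supporting line**: `Θ j·x i − V i ≤ Θ j·x j − V j` for all chain indices `i, j ≤ n`, strictly if `i ≠ j`
(the chord laws of `…TropicalBChordSlack`). [this seat] -/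
theorem weight_lt_of_ne {i j : ℕ} (hi : i ≤ n) (hj : j ≤ n) (hij : i ≠ j) :
    Θ j * IntervalOpt.sl d univ (P i) - IntervalOpt.cst v univ (P i) < Θ j * IntervalOpt.sl d univ (P j) - IntervalOpt.cst v univ (P j) := by
  rcases Nat.lt_or_gt_of_ne hij with h | h
  · -- `i < j`: `V j − V i < Θ j (x j − x i)`
    have := ChordSlack.chord_lt (S := fun i => IntervalOpt.sl d univ (P i)) (C := fun i => IntervalOpt.cst v univ (P i)) hΘ hsw h hj
    linarith
  · -- `j < i`: `Θ j (x i − x j) < V i − V j`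
    have := ChordSlack.lt_chord (S := fun i => IntervalOpt.sl d univ (P i)) (C := fun i => IntervalOpt.cst v univ (P i)) hΘ hsw h hi
    linarith

/-- weak form: `Θ j·x i − V i ≤ Θ j·x j − V j` for all `i, j ≤ n`. [this seat] -/
theorem weight_le {i j : ℕ} (hi : i ≤ n) (hj : j ≤ n) :
    Θ j * IntervalOpt.sl d univ (P i) - IntervalOpt.cst v univ (P i) ≤ Θ j * IntervalOpt.sl d univ (P j) - IntervalOpt.cst v univ (P j) := by
  by_cases hij : i = j
  · subst hij; exact le_rfl
  · exact (weight_lt_of_ne d v hΘ hsw hi hj hij).le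

/-- **a competitor strictly below a chord is beaten at every chain slope**: if `x k ≤ x_q ≤ x (k+1)` and
`(V_q − V k)(x (k+1) − x k) > (x_q − x k)(V (k+1) − V k)` then `Θ j·x_q − V_q < Θ j·x j − V j` for every `j ≤ n`. [this seat] -/
theorem weight_lt_of_below_chord {j k : ℕ} (hj : j ≤ n) (hk : k < n) (q : Equiv.Perm (Fin m) × (Fin m → Fin K))
    (hx₁ : IntervalOpt.sl d univ (P k) ≤ IntervalOpt.sl d univ q) (hx₂ : IntervalOpt.sl d univ q ≤ IntervalOpt.sl d univ (P (k + 1)))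
    (hbelow : (IntervalOpt.sl d univ q - IntervalOpt.sl d univ (P k)) * (IntervalOpt.cst v univ (P (k + 1)) - IntervalOpt.cst v univ (P k)) <
      (IntervalOpt.cst v univ q - IntervalOpt.cst v univ (P k)) * (IntervalOpt.sl d univ (P (k + 1)) - IntervalOpt.sl d univ (P k))) :
    Θ j * IntervalOpt.sl d univ q - IntervalOpt.cst v univ q < Θ j * IntervalOpt.sl d univ (P j) - IntervalOpt.cst v univ (P j) := by
  set xq := IntervalOpt.sl d univ q
  set Vq := IntervalOpt.cst v univ q
  set x0 := IntervalOpt.sl d univ (P k)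
  set x1 := IntervalOpt.sl d univ (P (k + 1))
  set V0 := IntervalOpt.cst v univ (P k)
  set V1 := IntervalOpt.cst v univ (P (k + 1))
  have hΔ : 0 < x1 - x0 := by
    have := NewtonPolygon.step_pos (S := fun i => IntervalOpt.sl d univ (P i)) (C := fun i => IntervalOpt.cst v univ (P i)) hΘ hsw hk
    linarith
  have h0 := weight_le d v hΘ hsw (i := k) (j := j) hk.le hj
  have h1 := weight_le d v hΘ hsw (i := k + 1) (j := j) hk hj
  -- `Δ·(Θ j xq − Vq) < (Δ − a)(Θ j x0 − V0) + a (Θ j x1 − V1) ≤ Δ·w j`, with `Δ = x1 − x0`, `a = xq − x0`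
  have ha0 : 0 ≤ xq - x0 := by linarith
  have ha1 : 0 ≤ x1 - xq := by linarith
  have key : (x1 - x0) * (Θ j * xq - Vq) <
      (x1 - xq) * (Θ j * x0 - V0) + (xq - x0) * (Θ j * x1 - V1) := by nlinarith
  have key2 : (x1 - xq) * (Θ j * x0 - V0) + (xq - x0) * (Θ j * x1 - V1) ≤
      (x1 - x0) * (Θ j * IntervalOpt.sl d univ (P j) - IntervalOpt.cst v univ (P j)) := by nlinarith
  have := lt_of_lt_of_le key key2
  exact lt_of_mul_lt_mul_left this hΔ.le

/-- **HULL CRITERION.**  Sandwich on the chain, chain terms present, and every other present term below the left ray, the right ray or some chord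
⇒ every chain term is the unique optimum at its slope. [this seat; folklore hull geometry] -/
theorem isDominant_of_hull (hpres : ∀ k, k ≤ n → termSign ε (P k) ≠ 0)
    (hcomp : ∀ q : Equiv.Perm (Fin m) × (Fin m → Fin K), termSign ε q ≠ 0 → (∀ k, k ≤ n → q ≠ P k) →
      (IntervalOpt.sl d univ q < IntervalOpt.sl d univ (P 0) ∧
          IntervalOpt.cst v univ (P 0) - IntervalOpt.cst v univ q < Θ 0 * (IntervalOpt.sl d univ (P 0) - IntervalOpt.sl d univ q)) ∨
      (IntervalOpt.sl d univ (P n) < IntervalOpt.sl d univ q ∧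
          Θ n * (IntervalOpt.sl d univ q - IntervalOpt.sl d univ (P n)) < IntervalOpt.cst v univ q - IntervalOpt.cst v univ (P n)) ∨
      (∃ k, k < n ∧ IntervalOpt.sl d univ (P k) ≤ IntervalOpt.sl d univ q ∧ IntervalOpt.sl d univ q ≤ IntervalOpt.sl d univ (P (k + 1)) ∧
          (IntervalOpt.sl d univ q - IntervalOpt.sl d univ (P k)) * (IntervalOpt.cst v univ (P (k + 1)) - IntervalOpt.cst v univ (P k)) <
            (IntervalOpt.cst v univ q - IntervalOpt.cst v univ (P k)) * (IntervalOpt.sl d univ (P (k + 1)) - IntervalOpt.sl d univ (P k))))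
    {j : ℕ} (hj : j ≤ n) : IsDominant d v ε (Θ j) (P j) := by
  refine ⟨hpres j hj, fun q hne hq => ?_⟩
  rw [NewtonPolygon.tropWeight_eq_sl_sub_cst, NewtonPolygon.tropWeight_eq_sl_sub_cst]
  by_cases hchain : ∃ i, i ≤ n ∧ q = P i
  · obtain ⟨i, hi, rfl⟩ := hchain
    exact weight_lt_of_ne d v hΘ hsw hi hj (fun h => hne (by rw [h]))
  · push Not at hchain
    rcases hcomp q hq (fun k hk h => hchain k hk h) with ⟨hxl, hl⟩ | ⟨hxr, hr⟩ | ⟨k, hk, hx₁, hx₂, hb⟩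
    · -- below the left ray: compare through `P 0`
      have hθ : Θ 0 ≤ Θ j := NewtonPolygon.mono_of_succ_lt hΘ (Nat.zero_le j) hj
      have h0 := weight_le d v hΘ hsw (i := 0) (j := j) (Nat.zero_le n) hj
      have : Θ j * (IntervalOpt.sl d univ (P 0) - IntervalOpt.sl d univ q) ≥ Θ 0 * (IntervalOpt.sl d univ (P 0) - IntervalOpt.sl d univ q) :=
        mul_le_mul_of_nonneg_right hθ (by linarith)
      linarith
    · -- below the right ray: compare through `P n`
      have hθ : Θ j ≤ Θ n := NewtonPolygon.mono_of_succ_lt hΘ hj le_rfl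
      have h0 := weight_le d v hΘ hsw (i := n) (j := j) le_rfl hj
      have : Θ j * (IntervalOpt.sl d univ q - IntervalOpt.sl d univ (P n)) ≤ Θ n * (IntervalOpt.sl d univ q - IntervalOpt.sl d univ (P n)) :=
        mul_le_mul_of_nonneg_right hθ (by linarith)
      linarith
    · exact weight_lt_of_below_chord d v hΘ hsw hj hk q hx₁ hx₂ hb

/-- **RIGID FORM**: if every present term is a chain term, the sandwich alone certifies the whole chain. [this seat] -/
theorem isDominant_of_rigid (hpres : ∀ k, k ≤ n → termSign ε (P k) ≠ 0)
    (hrigid : ∀ q : Equiv.Perm (Fin m) × (Fin m → Fin K), termSign ε q ≠ 0 → ∃ k, k ≤ n ∧ q = P k)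
    {j : ℕ} (hj : j ≤ n) : IsDominant d v ε (Θ j) (P j) := by
  refine isDominant_of_hull d v ε hΘ hsw hpres (fun q hq hnot => ?_) hj
  obtain ⟨k, hk, rfl⟩ := hrigid q hq
  exact absurd rfl (hnot k hk)

omit hΘ hsw in
/-- converse bookkeeping: the sandwich part of the criterion is NECESSARY — if every `P j` is dominant at `Θ j` and consecutive terms are distinct, the
sandwich holds (`NewtonPolygon.sandwich`); so for rigid supports «sandwich ⟺ dominant chain». [folklore] -/
theorem sandwich_of_isDominant (hdom : ∀ i, i ≤ n → IsDominant d v ε (Θ i) (P i)) (hne : ∀ i, i < n → P i ≠ P (i + 1)) :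
    ∀ i, i < n →
      Θ i * (IntervalOpt.sl d univ (P (i + 1)) - IntervalOpt.sl d univ (P i)) < IntervalOpt.cst v univ (P (i + 1)) - IntervalOpt.cst v univ (P i) ∧
        IntervalOpt.cst v univ (P (i + 1)) - IntervalOpt.cst v univ (P i) < Θ (i + 1) * (IntervalOpt.sl d univ (P (i + 1)) - IntervalOpt.sl d univ (P i)) :=
  fun _ hi => NewtonPolygon.sandwich d v ε hdom hne hi

end HullCriterion

end Summit.ValiantsHypothesis.ValiantsHypothesis.Theorems.KPlusLogSqLaw
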